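import Summits.QuantumFields.YangMills.Theorems.BalabanUVNodesN15KingModelRung
import Summits.QuantumFields.YangMills.Theorems.BalabanUVNodesSpineRates
import Literature.MathematicalPhysics.QuantumFieldTheory.King1986.CovarianceQstarRate

/-!
# BalabanUVNodes ∕ N15 — THE KING-MODEL RUNG, PART 3: the UNIT-LATTICE layer for King's block-field covariance `(Δ^{(K)})⁻¹`,
# the node's three-layer statement `N15At` DECIDED in King's `A = 0` model, and — as theorems — WHAT THE CURVED CASE ADDS
# (Track A, DAG node N15 = NE2; FAN-OUT v1.1 §N15 s3 «KING-MODEL ∕ RIEMANN-KERNEL RUNG», section 3 of 3)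

HONEST FRAMING.  Count-neutral kernel bookkeeping (cell `pub-ymgap`, seat `pub-ymgap-dag-n15-e` g0, strategy s3 «alternative
currency»; `--supports stmt-QuantumFields-19676` = K3 `SpineGivenEndpointR11`).  King's `A = 0` SCALAR MODEL ([King1986], TEMPLATE
literature, printed AND proved; torus theorems = the tree's `King1986.Torus.*`) — NOT Bałaban's covariant `G(U)`, `𝔅`-kernels,
`C^{(k)}(Λ; U)` of [Balaban1985BackgroundPropagators] Thms 3.1 ∕ 3.2 ∕ 3.15, for which NE2⁺ is NOT PRINTED and not proved; NOT a
node discharge (the carriers of record of Bałaban's run are NODE 00's, `S_N15 RRec` untouched); finite tori; nothing continuum ∕ ℝ⁴ ∕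
OS ∕ mass-gap ∕ Clay.  0 `sorry`, standard axioms; plumbing `def`s only (kernels written out, the carrier bundle).

CONTENTS.  Sections 1–2 (`…N15KingModelReadout` p457047, `…N15KingModelRung`) decided NE2's OPERATOR and SITE layers on the King-model
family `kingVolInstance d L` (= the knit lineage's `torusOpInstance` at Bałaban's volumes `Π_μ ℤ∕(2L^m)`, `K ≥ 1` coarse scales) for
King's propagator top piece `G^η_{(K)}`.  Here:
* §1 THE UNIT-LATTICE LAYER for King's BLOCK-FIELD COVARIANCE `(Δ^{(K)})⁻¹ = a_K⁻¹ + Q_KC^ηQ_K^*` — the unit-lattice covariance of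
  the `K`-fold block field of the free field `C^η` (King (2.10)–(2.14); the `C^ηQ^*_K` factor of (4.44), p. 675 *"from the convergence
  of C^ηQ^*_K"*): `blockCovStep` = level `K + 1` minus level `K` at unit sites, **`blockCov_step_le`** = the tree's
  `King1986.Torus.effLaplacian_inv_sub_decay` (`CovarianceQstarRate`, King's (4.39)–(4.41) for the effective Laplacian alone: rate
  `L^{−K}`, decay `κ_M∕2`, EVERY torus) BY NAME; **`ne2PlusUnit_blockCov`** ∕ `ne2ZeroUnit_blockCov`: `NE2PlusUnit c35 (kingVolInstance d L)
  (blockCovUnit L a m²) (fun _ _ => True) (kingUnitDist L)` with `(δ₀, a₀, B₀, θ) = (κ_M∕2, 1, C_diff + 1, L⁻¹)`, `inΛ := True` (written `fun _ _ => True`: no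
  large-field holes at `A = 0`), `unitDist :=` King's `tdistT`, HYPOTHESIS-FREE (`L ≥ 2`, `a, m² > 0`).  HONEST: this is NOT King's
  next-step fluctuation covariance `C^{(k)} = (Δ^{(k)} + aL⁻²Q*Q)⁻¹` of (2.16)∕(4.32) = Lemma 4.5 (4.38) — the node's printed scalar
  template of record, which seat dag-n15-d reads (`…N15KingModelNE2`, `king_lemma45_torus`); the two covariances are siblings
  (same mechanism (4.39)–(4.41), with ∕ without the next blocking term).
* §2 **`n15_kingModelRung`** — THE NODE SHAPE DECIDED (TRUE) IN THE MODEL: for odd `L ≥ 3`, `a, m² > 0`, `0 < γ ≤ 1`, every `d′`,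
  `p`, `c35`: `NE2PlusOperator c35 _ (topPieceOp L a m²) ∧ NE2PlusSite d′ p c35 _ (topPieceSite L a m²) ∧ NE2PlusUnit c35 _
  (blockCovUnit L a m²) (fun _ _ => True) (kingUnitDist L)` on the ONE family `kingVolInstance d L` — THREE King objects (`G^η_{(K)}`
  as operator, `G^η_{(K)}` as site kernel, `(Δ^{(K)})⁻¹` as unit kernel), every analytic input a printed-and-kernel-checked King
  theorem by name; `n15zero_kingModelRung` (the three NE2⁰ layers); **`n15At_kingModelRung`**: the K4 by-name statement
  `YMDAG.UVSplit.N15At` of route module `BalabanUVNodesSpineRates` HOLDS at the King-model carrier bundle `kingVolCarriers` on the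
  four-dimensional unit tori (`d + 1 = 4`) — «NE2_in_KingModel».  `S_N15 RRec` (the node AT THE CARRIERS OF RECORD) is not
  touched: no `RRec` is instantiated here (cf. n27-a `N15AtSpineCarriers.s_N15_fires_on_knitCarriers` for the LG knit).
* §3 WHAT THE CURVED CASE ADDS, AS THEOREMS: on ANY family whose background sort is ONE POINT (and on which (3.35)∕(3.36) hold
  at `U ≡ 1`), the NE2⁺ layers ARE the NE2⁰ layers — `ne2PlusOperator_iff_ne2ZeroOperator`, `ne2PlusSite_iff_ne2ZeroSite`,
  `ne2PlusUnit_iff_ne2ZeroUnit` (generic), instantiated at the King-model family (`…_kingVol`).  So the model decides NE2 up to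
  EXACTLY the background quantifier: Bałaban's NE2⁺ asks the same three inequalities for the `U`-dependent covariant objects
  UNIFORMLY over the LIVE window `Reg335 ∕ Reg336 c35 α₀ U` ([B9] (3.35)–(3.36) p. 396) on the multiscale tower `𝔅 = ⋃_j Λ_j` with
  the `(L^jη)^{−p}` prefactors — where print gives analyticity in `U` ([B9] Thm 3.4 p. 400, tree `B9.Thm34Printed`) and uniformity
  in `η`, never an η-difference (`T4EtaRate` header, GAPS G-t4-U1a-1); the typed socket for the unit layer with a live background
  is n15-a's `N15Knit.N15unit_of_kingLeaves` (cited, not restated).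
Locators: [King1986] CMP 102 (1986): (2.10)–(2.17) pp. 652–653, p. 664, Prop. 3.9 (3.73) p. 665, Lemma 4.3 (4.18) p. 672,
(4.32)–(4.34), Lemma 4.5 (4.38) p. 674, (4.39)–(4.41), (4.44) p. 675; [B9] = [Balaban1985BackgroundPropagators] CMP 99 (1985):
(3.35)–(3.36) p. 396, Thm 3.1 (3.42) p. 397, Thm 3.2 (3.48) p. 398, Thm 3.4 p. 400, Thm 3.15 (3.187) p. 432.
-/

noncomputable section

namespace Summit.QuantumFields.YangMills.BalabanUVNodes.N15KingModelRung

open Real Finset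
open Literature.MathematicalPhysics.QuantumFieldTheory.Balaban1983to89
open Literature.MathematicalPhysics.QuantumFieldTheory.Balaban1983to89.T4EtaRate (PairedInstance EtaRateIneq342 EtaRateIneqSite
  EtaRateIneqUnit NE2PlusOperator NE2PlusSite NE2PlusUnit NE2ZeroOperator ne2Zero_of_ne2Plus rateFactor)
open Literature.MathematicalPhysics.QuantumFieldTheory.Balaban1983to89.T4EtaRateSiteOfRatePair (NE2ZeroSite)
open Literature.MathematicalPhysics.QuantumFieldTheory.Balaban1983to89.T4EtaRateUnitWitness (NE2ZeroUnit ne2ZeroUnit_of_ne2PlusUnit)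
open Literature.MathematicalPhysics.QuantumFieldTheory.Balaban1983to89.T4EtaRateSiteTorus (TorusIndex)
open Literature.MathematicalPhysics.QuantumFieldTheory.Balaban1983to89.T4EtaRateOperatorTorus (torusOpGeo torusOpInstance)
open Literature.MathematicalPhysics.QuantumFieldTheory.Balaban1983to89.T4EtaRateDefectSite (pt9Bg)
open Literature.MathematicalPhysics.QuantumFieldTheory.Balaban1983to89.B5Prop11Plancherel (Tor fine)
open Literature.MathematicalPhysics.QuantumFieldTheory.King1986 (aK)
open Literature.MathematicalPhysics.QuantumFieldTheory.King1986.Torus (effLaplacian tdistT effLaplacian_inv_sub_decay CdiffM kapM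
  CdiffM_nonneg kapM_pos_le)
open Summit.QuantumFields.YangMills.BalabanUVNodes.N18KingModel (kingTheta_pos kingTheta_lt_one)
open YMDAG.UVSplit (NE2Carriers N15At)

variable {d : ℕ}

/-! ## §1 The unit-lattice layer: King's block-field covariance `(Δ^{(K)})⁻¹` -/

section Unit

variable (L : ℕ) [NeZero L]

/-- KING'S BLOCK-FIELD COVARIANCE at unit sites: `(Δ^{(K)})⁻¹(b, b′)` for the volume `M`, fine level `N = L^K`, `a_K = aK a L K`, `c = N²`,
mass `m²` — the inverse of King's effective Laplacian `Δ^{(K)} = a_K − a_K²Q_KG^η_KQ_K^*` (2.14)∕(4.5), i.e. `a_K⁻¹ + Q_KC^ηQ_K^*`, the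
unit-lattice covariance of the `K`-fold block field. [cite: King1986, (2.10)–(2.14) pp.652–653, (4.5) p.670] -/
def blockCov (Nf : ℕ) [NeZero Nf] (M : Fin (d + 1) → ℕ) [∀ μ, NeZero (M μ)] (a m2 : ℝ) (K : ℕ) (b b' : Tor M) : ℝ :=
  (effLaplacian Nf M (aK a L K) (((Nf : ℕ) : ℝ) ^ 2) m2)⁻¹ b b'

/-- THE η-DIFFERENCE KERNEL OF THE BLOCK-FIELD COVARIANCE at index `j`: level `K + 1` minus level `K` at the unit sites `b, b′`.
[cite: King1986, (4.39)–(4.41) pp.674–675 (mechanism), p.675 («convergence of C^ηQ^*_K»)] -/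
def blockCovStep (a m2 : ℝ) (j : KingVolIndex d) (b b' : Tor (kingVol L j)) : ℝ :=
  haveI := kingVol_neZero L j
  blockCov L (L ^ 1 * L ^ j.K) (kingVol L j) a m2 (j.K + 1) b b' - blockCov L (L ^ j.K) (kingVol L j) a m2 j.K b b'

/-- The block-field covariance's η-difference as the UNIT-LAYER site kernel on the King-model family. [cite: Balaban1985BackgroundPropagators, Thm 3.15 (3.187) p.432 (shape); King1986, (4.41) p.675 (object)] -/
def blockCovUnit (a m2 : ℝ) : ∀ j : KingVolIndex d, B9.SiteKernel (kingVolInstance d L j).gc (kingVolInstance d L j).Bf :=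
  fun j => ⟨fun _ b b' => blockCovStep L a m2 j b b'⟩

/-- `unitDist :=` King's unit-torus distance `tdistT` (= the carrier's distance, `tdistT_eq_dist`). [cite: King1986, Lemma 4.5 (4.38) p.674 (the distance |x − y|)] -/
def kingUnitDist : ∀ j : KingVolIndex d, (kingVolInstance d L j).gc.Site → (kingVolInstance d L j).gc.Site → ℝ :=
  fun j y y' =>
    haveI := kingVol_neZero L j
    tdistT (kingVol L j) y y'

/-- **THE TWO-SPACING RATE OF THE BLOCK-FIELD COVARIANCE ON THE KING-MODEL FAMILY** (`L ≥ 2`, `a, m² > 0`): for EVERY index and all unit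
sites, `|(Δ^{(K+1)})⁻¹(b, b′) − (Δ^{(K)})⁻¹(b, b′)| ≤ C_diff·(L^K)⁻¹·e^{−(κ_M∕2)|b − b′|_T}` — `King1986.Torus.effLaplacian_inv_sub_decay` at
`n = 1` BY NAME (constants `C_diff = CdiffM (d+1) a m² L ≥ 0`, `κ_M = kapM (d+1) a m² L > 0`, functions of `d, L, a, m²` only).
[cite: King1986, (4.39)–(4.41) pp.674–675, Lemma 4.3 (4.18) p.672] -/
theorem blockCov_step_le (hL : 2 ≤ L) {a m2 : ℝ} (ha : 0 < a) (hm : 0 < m2) (j : KingVolIndex d) (b b' : Tor (kingVol L j)) :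
    haveI := kingVol_neZero L j
    |blockCovStep L a m2 j b b'| ≤
      CdiffM (d + 1) a m2 L * ((L : ℝ) ^ j.K)⁻¹ * Real.exp (-(kapM (d + 1) a m2 L / 2 * tdistT (kingVol L j) b b')) := by
  haveI := kingVol_neZero L j
  exact effLaplacian_inv_sub_decay ha hm hL j.one_le_K le_rfl (kingVol L j) b b'

/-- **THE TYPED UNIT INEQUALITY FOR THE BLOCK-FIELD COVARIANCE, UNIFORMLY** (`L ≥ 2`, `a, m² > 0`): for EVERY index and (the unique)
background, `EtaRateIneqUnit (blockCovUnit L a m² j) (fun _ => True) (kingUnitDist L j) (C_diff + 1) (κ_M∕2) L⁻¹ K` — rate `θ = L⁻¹`,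
`θ^K = (L^K)⁻¹`. [cite: Balaban1985BackgroundPropagators, Thm 3.15 (3.187) p.432 (shape); King1986, (4.41) p.675] -/
theorem etaRateIneqUnit_blockCov (hL : 2 ≤ L) {a m2 : ℝ} (ha : 0 < a) (hm : 0 < m2) (j : KingVolIndex d)
    (U : (kingVolInstance d L j).Bf.Cfg) :
    EtaRateIneqUnit (blockCovUnit L a m2 j) (fun _ => True) (kingUnitDist L j) (CdiffM (d + 1) a m2 L + 1)
      (kapM (d + 1) a m2 L / 2) ((L : ℝ)⁻¹) j.K U := by
  intro y y' _ _
  haveI := kingVol_neZero L j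
  have h := blockCov_step_le (d := d) L hL ha hm j y y'
  have hexp := Real.exp_pos (-(kapM (d + 1) a m2 L / 2 * tdistT (kingVol L j) y y'))
  have hLK : 0 ≤ ((L : ℝ) ^ j.K)⁻¹ := by positivity
  show |blockCovStep L a m2 j y y'| ≤
    (CdiffM (d + 1) a m2 L + 1) * Real.exp (-(kapM (d + 1) a m2 L / 2 * tdistT (kingVol L j) y y')) * ((L : ℝ)⁻¹) ^ j.K
  rw [inv_pow]
  calc |blockCovStep L a m2 j y y'|
      ≤ CdiffM (d + 1) a m2 L * ((L : ℝ) ^ j.K)⁻¹ * Real.exp (-(kapM (d + 1) a m2 L / 2 * tdistT (kingVol L j) y y')) := h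
    _ ≤ (CdiffM (d + 1) a m2 L + 1) * ((L : ℝ) ^ j.K)⁻¹ *
          Real.exp (-(kapM (d + 1) a m2 L / 2 * tdistT (kingVol L j) y y')) := by
        gcongr
        linarith
    _ = (CdiffM (d + 1) a m2 L + 1) * Real.exp (-(kapM (d + 1) a m2 L / 2 * tdistT (kingVol L j) y y')) *
          ((L : ℝ) ^ j.K)⁻¹ := by ring

/-- **`NE2PlusUnit` IS INHABITED BY KING'S BLOCK-FIELD COVARIANCE ON THE KING-MODEL FAMILY, HYPOTHESIS-FREE** (`L ≥ 2`, `a, m² > 0`, every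
`c35`): `(δ₀, a₀, B₀, θ) = (κ_M∕2, 1, C_diff + 1, L⁻¹)`, uniform in `(m, K, Msz)`.  HONEST SCOPE: backgrounds range over `{U ≡ 1}`;
the object is `(Δ^{(K)})⁻¹`, not the next-step fluctuation covariance `C^{(k)}` of Lemma 4.5 (seat n15-d's kernel).
[cite: Balaban1985BackgroundPropagators, Thm 3.15 (3.187) p.432 (quantifier template); King1986, (4.39)–(4.41) pp.674–675] -/
theorem ne2PlusUnit_blockCov (hL : 2 ≤ L) {a m2 : ℝ} (ha : 0 < a) (hm : 0 < m2) (c35 : ℝ) :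
    NE2PlusUnit c35 (kingVolInstance d L) (blockCovUnit L a m2) (fun _ _ => True) (kingUnitDist L) := by
  have hLpos : (0 : ℝ) < L := by exact_mod_cast (lt_of_lt_of_le zero_lt_two hL)
  have hθ1 : (L : ℝ)⁻¹ < 1 := inv_lt_one_of_one_lt₀ (by exact_mod_cast hL)
  have hC : 0 < CdiffM (d + 1) a m2 L + 1 := by linarith [CdiffM_nonneg (d := d + 1) ha hm hL]
  exact ⟨kapM (d + 1) a m2 L / 2, 1, CdiffM (d + 1) a m2 L + 1, (L : ℝ)⁻¹, half_pos (kapM_pos_le ha hm hL).1, one_pos, hC,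
    inv_pos.mpr hLpos, hθ1, fun j _ _ _ U _ _ => etaRateIneqUnit_blockCov L hL ha hm j U⟩

/-- **`NE2ZeroUnit` HOLDS FOR KING'S BLOCK-FIELD COVARIANCE** (same data): the lineage's `ne2ZeroUnit_of_ne2PlusUnit` (sizes `Msz ≥ 1 > 0`,
trivial regularity). [cite: King1986, (4.41) p.675 (A = 0 model)] -/
theorem ne2ZeroUnit_blockCov (hL : 2 ≤ L) {a m2 : ℝ} (ha : 0 < a) (hm : 0 < m2) :
    NE2ZeroUnit (kingVolInstance d L) (blockCovUnit L a m2) (fun _ _ => True) (kingUnitDist L) :=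
  ne2ZeroUnit_of_ne2PlusUnit (c35 := 0) (fun j => lt_of_lt_of_le one_pos j.one_le_Msz) (fun _ _ _ => trivial)
    (fun _ _ _ => trivial) (ne2PlusUnit_blockCov L hL ha hm 0)

end Unit

/-! ## §2 The node shape decided in the model: the three layers on ONE family, and `N15At` at the King-model carriers -/

section Node

variable (L : ℕ) [NeZero L]

/-- **NE2 IN KING'S MODEL — THE THREE LAYERS ON ONE FAMILY, HYPOTHESIS-FREE** (odd `L ≥ 3`, `a, m² > 0`, `0 < γ ≤ 1`; every `d′`, `p`,
`c35`): on `kingVolInstance d L`, `NE2PlusOperator` for the top piece `G^η_{(K)}` (Prop. 3.9, p. 675; rate `L^{−γ∕2}`) ∧ `NE2PlusSite d′ p`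
for the same kernel ∧ `NE2PlusUnit` for the block-field covariance `(Δ^{(K)})⁻¹` ((4.41); `θ = L⁻¹`) — sections 1–2 and §1 BY NAME.
HONEST SCOPE: `A = 0` (one-point backgrounds), single top scale read at block base points, Bałaban's volumes `2L^m`; NOT Bałaban's
objects, NOT a node discharge. [cite: King1986, Prop. 3.9 (3.73) p.665, p.675, (4.39)–(4.41) pp.674–675; Balaban1985BackgroundPropagators, Thm 3.1 p.397 + Thm 3.2 (3.48) p.398 + Thm 3.15 (3.187) p.432 (quantifier templates)] -/
theorem n15_kingModelRung (hLodd : Odd L) (hL : 2 ≤ L) {a m2 : ℝ} (ha : 0 < a) (hm : 0 < m2) {γ : ℝ} (hγ0 : 0 < γ)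
    (hγ1 : γ ≤ 1) (d' : ℕ) (p c35 : ℝ) :
    NE2PlusOperator c35 (kingVolInstance d L) (topPieceOp L a m2) ∧
      NE2PlusSite d' p c35 (kingVolInstance d L) (topPieceSite L a m2) ∧
      NE2PlusUnit c35 (kingVolInstance d L) (blockCovUnit L a m2) (fun _ _ => True) (kingUnitDist L) :=
  ⟨ne2PlusOperator_topPiece L hLodd hL ha hm hγ0 hγ1 c35, ne2PlusSite_topPiece L hLodd hL ha hm hγ0 hγ1 d' p c35,
    ne2PlusUnit_blockCov L hL ha hm c35⟩

/-- **THE THREE TRIVIAL-BACKGROUND (NE2⁰) LAYERS IN KING'S MODEL** (same data): `NE2ZeroOperator` (the venue's `N15zero`) ∧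
`NE2ZeroSite d′ p` ∧ `NE2ZeroUnit`. [cite: King1986, Props. 3.8–3.9 (3.71)–(3.75) pp.664–665, Lemma 4.5 (4.38) p.674 (the A = 0 templates named in `T4EtaRate`)] -/
theorem n15zero_kingModelRung (hLodd : Odd L) (hL : 2 ≤ L) {a m2 : ℝ} (ha : 0 < a) (hm : 0 < m2) {γ : ℝ} (hγ0 : 0 < γ)
    (hγ1 : γ ≤ 1) (d' : ℕ) (p : ℝ) :
    NE2ZeroOperator (kingVolInstance d L) (topPieceOp L a m2) ∧
      NE2ZeroSite d' p (kingVolInstance d L) (topPieceSite L a m2) ∧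
      NE2ZeroUnit (kingVolInstance d L) (blockCovUnit L a m2) (fun _ _ => True) (kingUnitDist L) :=
  ⟨ne2ZeroOperator_topPiece L hLodd hL ha hm hγ0 hγ1, ne2ZeroSite_topPiece L hLodd hL ha hm hγ0 hγ1 d' p,
    ne2ZeroUnit_blockCov L hL ha hm⟩

/-- THE KING-MODEL CARRIER BUNDLE for the K4 node statement (`YMDAG.UVSplit.NE2Carriers` of route module `BalabanUVNodesSpineRates`) on the
FOUR-DIMENSIONAL unit tori (`d + 1 = 4`): index `KingVolIndex 3`, regularity letter `c35`, site exponent `p`, paired instances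
`kingVolInstance 3 L`, operator family = the top piece, site kernels = the top piece, unit kernels = the block-field covariance,
`inΛ := True`, `unitDist := tdistT`.  NOT the carriers of record (those are NODE 00's; no `RRec` is instantiated). [cite: King1986, (2.17) p.653, (4.41) and (4.44) p.675 (objects)] -/
def kingVolCarriers (a m2 c35 p : ℝ) : NE2Carriers where
  I := KingVolIndex 3
  c35 := c35
  p := p
  pi := kingVolInstance 3 L
  Kop := topPieceOp L a m2
  Ksite := topPieceSite L a m2
  Kunit := blockCovUnit L a m2
  inΛ := fun _ _ => True
  unitDist := kingUnitDist L

/-- **«NE2_in_KingModel»: THE K4 BY-NAME STATEMENT `N15At` HOLDS AT THE KING-MODEL CARRIERS, HYPOTHESIS-FREE** (odd `L ≥ 3`, `a, m² > 0`,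
`0 < γ ≤ 1`, every `c35`, `p`; `d + 1 = 4`): `N15At (kingVolCarriers L a m² c35 p)` = `NE2PlusOperator ∧ NE2PlusSite 4 p ∧ NE2PlusUnit`
on ONE family — node N15's typed statement is satisfied, with content (`δ > 0`, rates `L^{−γ∕2}`, `L⁻¹` in `]0, 1[`, index inhabited,
size letter free), by King's printed model.  NOT `S_N15 RRec` (the node at the carriers OF RECORD), NOT a discharge.
[cite: King1986, Prop. 3.9 (3.73) p.665, p.675, (4.39)–(4.41) pp.674–675; Balaban1985BackgroundPropagators, Thm 3.1 p.397 + Thm 3.2 (3.48) p.398 + Thm 3.15 (3.187) p.432 (quantifier templates)] -/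
theorem n15At_kingModelRung (hLodd : Odd L) (hL : 2 ≤ L) {a m2 : ℝ} (ha : 0 < a) (hm : 0 < m2) {γ : ℝ} (hγ0 : 0 < γ)
    (hγ1 : γ ≤ 1) (c35 p : ℝ) : N15At (kingVolCarriers L a m2 c35 p) :=
  n15_kingModelRung (d := 3) L hLodd hL ha hm hγ0 hγ1 4 p c35

/-- The King-model bundle is NOT the empty-index trap (n27-a `N15AtSpineCarriers.n15At_of_isEmpty`): its index type is inhabited. [folklore] -/
theorem kingVolCarriers_index_nonempty (a m2 c35 p : ℝ) : Nonempty (kingVolCarriers L a m2 c35 p).I :=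
  kingVolIndex_nonempty 3

end Node

/-! ## §3 What the curved case adds, as theorems: on a one-point background sort the NE2⁺ layers ARE the NE2⁰ layers -/

section Curved

variable {I : Type} {pi : I → PairedInstance}

/-- **OPERATOR LAYER: NE2⁺ ⟺ NE2⁰ ON ONE-POINT BACKGROUNDS.**  For ANY family whose background sort is a subsingleton on which (3.35)
holds at `U ≡ 1` for every `α₀ > 0`, and any kernel family: `NE2PlusOperator c35 pi Kd ↔ NE2ZeroOperator pi Kd` (every `c35`).  Hence
the model decides the layer up to EXACTLY the background quantifier `∀ U, Reg335 c35 α₀ U → …` over a LIVE background sort — what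
Bałaban's `G(U)` adds ([B9] Thm 3.1: uniformity over (3.35)-regular `U`; background control in print = analyticity, Thm 3.4).
[cite: Balaban1985BackgroundPropagators, (3.35) p.396, Thm 3.1 p.397, Thm 3.4 p.400] [folklore] -/
theorem ne2PlusOperator_iff_ne2ZeroOperator {Kd : ∀ i, B9.KernelFamily (pi i).gc (pi i).Bf} (c35 : ℝ)
    (hsub : ∀ i, Subsingleton (pi i).Bf.Cfg)
    (hreg : ∀ (i : I) (α₀ : ℝ), 0 < α₀ → (pi i).Bf.Reg335 c35 α₀ (pi i).Bf.one) :
    NE2PlusOperator c35 pi Kd ↔ NE2ZeroOperator pi Kd := by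
  refine ⟨ne2Zero_of_ne2Plus hreg, fun h => ?_⟩
  obtain ⟨M₅, δ₀, B₀, γ, hM, hδ, hB, hγ, H⟩ := h
  refine ⟨M₅, δ₀, 1, B₀, γ, hM, hδ, one_pos, hB, hγ, fun i hMi α₀ _ _ U _ => ?_⟩
  rw [(hsub i).elim U (pi i).Bf.one]
  exact H i hMi

/-- **SITE LAYER: NE2⁺ ⟺ NE2⁰ ON ONE-POINT BACKGROUNDS** (every exponent pair, every `c35`). [cite: Balaban1985BackgroundPropagators, (3.35) p.396, Thm 3.2 (3.48) p.398] [folklore] -/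
theorem ne2PlusSite_iff_ne2ZeroSite {Kd : ∀ i, B9.SiteKernel (pi i).gc (pi i).Bf} (d' : ℕ) (p c35 : ℝ)
    (hsub : ∀ i, Subsingleton (pi i).Bf.Cfg)
    (hreg : ∀ (i : I) (α₀ : ℝ), 0 < α₀ → (pi i).Bf.Reg335 c35 α₀ (pi i).Bf.one) :
    NE2PlusSite d' p c35 pi Kd ↔ NE2ZeroSite d' p pi Kd := by
  constructor
  · rintro ⟨M₅, δ, a₀, C, γ, hM, hδ, ha, hC, hγ, H⟩
    refine ⟨M₅, δ, C, γ, hM, hδ, hC, hγ, fun i hMi => ?_⟩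
    have hMpos : 0 < (pi i).gf.M := lt_of_lt_of_le hM hMi
    have hα : 0 < a₀ / (pi i).gf.M := div_pos ha hMpos
    exact H i hMi _ hα (by rw [mul_div_cancel₀ _ hMpos.ne']) _ (hreg i _ hα)
  · rintro ⟨M₅, δ, C, γ, hM, hδ, hC, hγ, H⟩
    refine ⟨M₅, δ, 1, C, γ, hM, hδ, one_pos, hC, hγ, fun i hMi α₀ _ _ U _ => ?_⟩
    rw [(hsub i).elim U (pi i).Bf.one]
    exact H i hMi

/-- **UNIT LAYER: NE2⁺ ⟺ NE2⁰ ON ONE-POINT BACKGROUNDS** (positive sizes, (3.35)∧(3.36) at `U ≡ 1`; every `c35`) — what Bałaban's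
`C^{(k)}(Λ; U)` adds is the uniformity over the (3.35)∧(3.36)-regular backgrounds of Thm 3.15 (the typed socket with a live background:
n15-a's `N15Knit.N15unit_of_kingLeaves`). [cite: Balaban1985BackgroundPropagators, (3.35)–(3.36) p.396, Thm 3.15 (3.187) p.432] [folklore] -/
theorem ne2PlusUnit_iff_ne2ZeroUnit {Kd : ∀ i, B9.SiteKernel (pi i).gc (pi i).Bf} {inΛ : ∀ i, (pi i).gc.Site → Prop}
    {unitDist : ∀ i, (pi i).gc.Site → (pi i).gc.Site → ℝ} (c35 : ℝ)
    (hsub : ∀ i, Subsingleton (pi i).Bf.Cfg) (hM : ∀ i, 0 < (pi i).gf.M)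
    (h335 : ∀ (i : I) (α₀ : ℝ), 0 < α₀ → (pi i).Bf.Reg335 c35 α₀ (pi i).Bf.one)
    (h336 : ∀ (i : I) (α₀ : ℝ), 0 < α₀ → (pi i).Bf.Reg336 c35 α₀ (pi i).Bf.one) :
    NE2PlusUnit c35 pi Kd inΛ unitDist ↔ NE2ZeroUnit pi Kd inΛ unitDist := by
  refine ⟨ne2ZeroUnit_of_ne2PlusUnit hM h335 h336, fun h => ?_⟩
  obtain ⟨δ₀, B₀, θ, hδ, hB, hθ0, hθ1, H⟩ := h
  refine ⟨δ₀, 1, B₀, θ, hδ, one_pos, hB, hθ0, hθ1, fun i α₀ _ _ U _ _ => ?_⟩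
  rw [(hsub i).elim U (pi i).Bf.one]
  exact H i

variable (L : ℕ) [NeZero L]

/-- AT THE KING-MODEL FAMILY the background sort is ONE point and (3.35)∕(3.36) read `True`: the three equivalences apply — in King's model
NE2⁺ = NE2⁰ for EVERY kernel family; the curved case is the live-background quantifier and nothing else at this level of typing.
[cite: Balaban1985BackgroundPropagators, (3.35)–(3.36) p.396; King1986, p.670 («and A = 0, of course»)] [folklore] -/
theorem ne2Plus_iff_ne2Zero_kingVol (c35 : ℝ) (d' : ℕ) (p : ℝ)
    (Kop : ∀ j : KingVolIndex d, B9.KernelFamily (kingVolInstance d L j).gc (kingVolInstance d L j).Bf)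
    (Ksite Kunit : ∀ j : KingVolIndex d, B9.SiteKernel (kingVolInstance d L j).gc (kingVolInstance d L j).Bf)
    (inΛ : ∀ j : KingVolIndex d, (kingVolInstance d L j).gc.Site → Prop)
    (unitDist : ∀ j : KingVolIndex d, (kingVolInstance d L j).gc.Site → (kingVolInstance d L j).gc.Site → ℝ) :
    (NE2PlusOperator c35 (kingVolInstance d L) Kop ↔ NE2ZeroOperator (kingVolInstance d L) Kop) ∧
      (NE2PlusSite d' p c35 (kingVolInstance d L) Ksite ↔ NE2ZeroSite d' p (kingVolInstance d L) Ksite) ∧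
      (NE2PlusUnit c35 (kingVolInstance d L) Kunit inΛ unitDist ↔ NE2ZeroUnit (kingVolInstance d L) Kunit inΛ unitDist) :=
  ⟨ne2PlusOperator_iff_ne2ZeroOperator c35 (fun _ => instSubsingletonPUnit) (fun _ _ _ => trivial),
    ne2PlusSite_iff_ne2ZeroSite d' p c35 (fun _ => instSubsingletonPUnit) (fun _ _ _ => trivial),
    ne2PlusUnit_iff_ne2ZeroUnit c35 (fun _ => instSubsingletonPUnit) (fun j => lt_of_lt_of_le one_pos j.one_le_Msz)
      (fun _ _ _ => trivial) (fun _ _ _ => trivial)⟩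

end Curved

end Summit.QuantumFields.YangMills.BalabanUVNodes.N15KingModelRung

end
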